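import Mathlib
import Literature.Analysis.FluidPDE.SuitableWeak
import Literature.Analysis.FluidPDE.NSSliceTimePairing
import Literature.Analysis.FluidPDE.DivCurlAnnihilator
import Summits.NavierStokesRegularity.NavierStokesRegularity.Theorems.EulerZoomLiouvillePowerGaugeEulerLiouvilleWeakAntiEquivariantMember
import Summits.NavierStokesRegularity.NavierStokesRegularity.Theorems.EulerZoomLiouvillePowerGaugeEulerLiouvilleDistributionallyAffine
import HarnessLib

/-!
# Crux `EulerZoomLiouville.PowerGaugeEulerLiouville` (stmt-NavierStokesRegularity-19832), stub `stub_nonSelfSimilarRest`: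
# FROZEN LAMB TERM — members whose (velocity-tested, Leray-projected) advection `P(ω × u)` is STEADY IN `𝒟'` on a past slab are trivial

Helper file (theorems only; `--supports stmt-NavierStokesRegularity-19832`; def-free).  Hand leafhand-ns-eulerzoomliouville-10 g4; the Euler SOURCE of the
affine-in-time stratum (hand 10 g3 census idea (L) «frozen Lamb vector»; a.e. kill hand 11 g0 `…AffineTimePast`, `𝒟'` form hand 10 g4 `…DistributionallyAffine`).

THE STRATUM (velocity-only, regularity-free).  A class member `(u, p, H, c)` and `T₁ ≤ 0` with
`∫∫ θ'(t) ⟪u(t,x), Dη(x)[u(t,x)]⟫ dx dt = 0` for every `θ ∈ C_c^∞((−∞,T₁))` and every divergence-free vector test field `η` — i.e. the advection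
functional `η ↦ ∫ (u ⊗ u)(t) : ∇η`, which on divergence-free `η` is the Leray projection of `div(u ⊗ u) = ω × u + ∇|u|²/2`, hence of the LAMB VECTOR
`ω × u`, is TIME-INDEPENDENT in `𝒟'((−∞,T₁))`.  Contains: every steady / a.e.-steady / distributionally steady member (hands g9–g3), every
(generalised-)Beltrami past (`P(ω × u) = 0`, hands g1/g3), and is killed here WITHOUT any ansatz.

PROOF.  (1) The distributional Euler momentum identity tested with `θ'(t) η(x)`, `η` divergence-free (`AntiMember.momentum_tensor` applied to `θ'`):
`∫∫ θ''⟪u, η⟫ + θ'⟪u, Dη[u]⟫ = 0`; the frozen advection kills the second term, so `∫∫ θ''(t) ⟪u, η⟫ = 0` for all divergence-free test `η`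
(`FrozenLamb.integral_deriv2_mul_inner_divFree_eq_zero`).  (2) Hence the TIME-TESTED FIELD `w = ∫ θ''(t) u(t,·) dt` is weakly curl-free (curl pairs are
divergence-free), weakly divergence-free (incompressibility), locally integrable with the `A`-gauge growth `∫_{B_r}|w|² ≤ K r^{1−2ρ}`, `1 − 2ρ < 3`: it
vanishes (`AntiMember.timeTested_ae_eq_zero`), i.e. `∫∫ θ''(t)⟪u, Φ⟫ = 0` for ALL continuous compactly supported `Φ` — `∂ₜ²u = 0` in `𝒟'`
(`FrozenLamb.integral_deriv2_mul_inner_eq_zero`).  (3) `Loc.ae_eq_zero_of_distributionallyAffinePast` (a.e. affine in time ⇒ trivial).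
Binder language: `Birth.nonSelfSimilar_of_frozenAdvectionPast`.

WHAT THIS IS NOT: not a proof of the stub or of the crux (the generic member has a genuinely time-dependent Lamb term); nothing about Navier–Stokes.
[folklore; MajdaBertozziCUP2002 §1.2 Prop. 1.1, §2.4]
-/

noncomputable section

-- flat `Theorems/<Route><Decl>…` files of one crux share the namespace of the crux (tree convention)
set_option linter.dupNamespace false

open MeasureTheory Set Filter Topology Metric Function TopologicalSpace
open scoped RealInnerProductSpace NNReal ENNReal ContDiff

namespace Summit.NavierStokesRegularity.NavierStokesRegularity.Theorems.PowerGaugeEulerLiouville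

open Literature.Analysis Literature.Analysis.FunctionSpaces Literature.Analysis.FluidPDE

namespace FrozenLamb

variable {u : ℝ → EuclideanSpace ℝ (Fin 3) → EuclideanSpace ℝ (Fin 3)}

/-! ## 1. Frozen advection ⇒ `∫∫ θ''⟪u, η⟫ = 0` for divergence-free `η` -/

/-- **FROZEN ADVECTION KILLS `∂ₜ²u` ON DIVERGENCE-FREE TESTS.**  If `(u, p)` is a distributional Euler pair on `(−∞,T₀) × ℝ³` (no force) whose
velocity-tested advection against a divergence-free test field `η` is steady in `𝒟'` for a `θ ∈ C_c^∞((−∞,T₁))`, `T₁ ≤ T₀` —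
`∫∫ θ'(t)⟪u, Dη[u]⟫ = 0` — then `∫∫ θ''(t) ⟪u(t,x), η(x)⟫ = 0` (momentum identity tested with `θ'(t)η(x)`). [folklore; MajdaBertozziCUP2002 §1.2] -/
theorem integral_deriv2_mul_inner_divFree_eq_zero {p : ℝ → EuclideanSpace ℝ (Fin 3) → ℝ} {T₀ T₁ : ℝ} (hT : T₁ ≤ T₀)
    (hdist : IsDistributionalNSSolutionOn (slab (EuclideanSpace ℝ (Fin 3)) (Iio T₀) isOpen_Iio) 0 0 u p)
    {θ : ℝ → ℝ} (hθ : ContDiff ℝ ∞ θ) (hθc : HasCompactSupport θ) (hθT : tsupport θ ⊆ Iio T₁)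
    {η : EuclideanSpace ℝ (Fin 3) → EuclideanSpace ℝ (Fin 3)} (hη : IsTestFunctionOn (⊤ : Opens (EuclideanSpace ℝ (Fin 3))) η)
    (hdiv : ∀ x, VectorCalculus.divergence η x = 0)
    (hfrozen : ∫ z : ℝ × EuclideanSpace ℝ (Fin 3), deriv θ z.1 * ⟪u z.1 z.2, fderiv ℝ η z.2 (u z.1 z.2)⟫ = 0) :
    ∫ z : ℝ × EuclideanSpace ℝ (Fin 3), deriv (deriv θ) z.1 * ⟪u z.1 z.2, η z.2⟫ = 0 := by
  have hθT₀ : tsupport θ ⊆ Iio T₀ := hθT.trans (Iio_subset_Iio hT)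
  obtain ⟨hκ, hκc, hκT⟩ := AntiMember.deriv_cutoff_props hθ hθc hθT₀
  have hθ' : ContDiff ℝ ∞ (deriv θ) := hθ.deriv'
  -- the momentum identity tested with `θ'(t) η(x)`
  have H1 := AntiMember.momentum_tensor hdist hθ' hκc hκT hη hdiv
  -- integrability of the two summands on `ℝ × ℝ³`
  obtain ⟨hκ2, hκ2c, hκ2T⟩ := AntiMember.deriv_cutoff_props hθ' hκc hκT
  have hu : LocallyIntegrableOn (uncurry u) (Iio T₀ ×ˢ (univ : Set (EuclideanSpace ℝ (Fin 3)))) volume := by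
    simpa only [coe_slab] using hdist.1
  have hum : AEStronglyMeasurable (uncurry u) (volume.restrict (Iio T₀ ×ˢ (univ : Set (EuclideanSpace ℝ (Fin 3))))) :=
    hu.aestronglyMeasurable
  have hu2 : LocallyIntegrableOn (fun z => ‖uncurry u z‖ ^ 2) (Iio T₀ ×ˢ (univ : Set (EuclideanSpace ℝ (Fin 3)))) volume := by
    simpa only [coe_slab] using hdist.2.1
  have iA := AntiMember.integrable_mul_inner_field hu hκ2 hκ2c hκ2T hη.contDiff.continuous hη.hasCompactSupport
  have iB := AntiMember.integrable_mul_inner_fderiv_apply hum hu2 hκ hκc hκT (hη.contDiff.of_le (by norm_cast))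
    hη.hasCompactSupport
  rw [integral_add iA iB, hfrozen, add_zero] at H1
  exact H1

/-! ## 2. Member level: frozen advection ⇒ `∂ₜ²u = 0` in `𝒟'` -/

/-- **A MEMBER WITH FROZEN ADVECTION HAS `∂ₜ²u = 0` IN `𝒟'` ON ITS PAST SLAB.**  Let `(u, p)` be a suitable weak Euler pair on `(−∞,0) × ℝ³` with the
`A`-gauge `a^{2ρ} A(a) ≤ c` (`ρ > −1`), and suppose its velocity-tested advection is steady in `𝒟'` before `T₁ ≤ 0` on CURL PAIRS
`η = (∂ₐg)b − (∂_b g)a` (`∫∫ θ'(t)⟪u, Dη[u]⟫ = 0`).  Then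
`∫∫ θ''(t) ⟪u(t,x), Φ(x)⟫ = 0` for every `θ ∈ C_c^∞((−∞,T₁))` and every continuous compactly supported field `Φ`: the time-tested field `∫ θ'' u`
is weakly curl- and divergence-free with sub-volume growth, hence zero. [folklore] -/
theorem integral_deriv2_mul_inner_eq_zero {ρ : ℝ} (hρ : -1 < ρ)
    {p : ℝ → EuclideanSpace ℝ (Fin 3) → ℝ} {c : ℝ≥0}
    (hsw : IsSuitableWeakSolutionOn (slab (EuclideanSpace ℝ (Fin 3)) (Iio 0) isOpen_Iio) 0 0 u p)
    (hA : ∀ a : ℝ, 0 < a → ENNReal.ofReal (a ^ (2 * ρ)) * cknA a (0 : ℝ × EuclideanSpace ℝ (Fin 3)) u ≤ (c : ℝ≥0∞))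
    {T₁ : ℝ} (hT₁ : T₁ ≤ 0)
    (hfrozen : ∀ θ : ℝ → ℝ, ContDiff ℝ ∞ θ → HasCompactSupport θ → tsupport θ ⊆ Iio T₁ →
      ∀ g : EuclideanSpace ℝ (Fin 3) → ℝ, IsTestFunctionOn (⊤ : Opens (EuclideanSpace ℝ (Fin 3))) g → ∀ a b : EuclideanSpace ℝ (Fin 3),
        ∫ z : ℝ × EuclideanSpace ℝ (Fin 3), deriv θ z.1 *
          ⟪u z.1 z.2, fderiv ℝ (fun x => fderiv ℝ g x a • b - fderiv ℝ g x b • a) z.2 (u z.1 z.2)⟫ = 0)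
    {θ : ℝ → ℝ} (hθ : ContDiff ℝ ∞ θ) (hθc : HasCompactSupport θ) (hθT : tsupport θ ⊆ Iio T₁)
    {Φ : EuclideanSpace ℝ (Fin 3) → EuclideanSpace ℝ (Fin 3)} (hΦ : Continuous Φ) (hΦc : HasCompactSupport Φ) :
    ∫ z : ℝ × EuclideanSpace ℝ (Fin 3), deriv (deriv θ) z.1 * ⟪u z.1 z.2, Φ z.2⟫ = 0 := by
  -- adapted from Theorems/EulerZoomLiouvillePowerGaugeEulerLiouvilleWeakAntiEquivariantMember.lean (`…_of_negPair`), with `θ'' ` for `θ'`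
  have hdist := hsw.distributional
  have hθT0 : tsupport θ ⊆ Iio 0 := hθT.trans (Iio_subset_Iio hT₁)
  have hθ' : ContDiff ℝ ∞ (deriv θ) := hθ.deriv'
  have hθ'' : ContDiff ℝ ∞ (deriv (deriv θ)) := hθ'.deriv'
  obtain ⟨-, hκ₁c, hκ₁T⟩ := AntiMember.deriv_cutoff_props hθ hθc hθT0
  obtain ⟨hκ, hκc, hκT⟩ := AntiMember.deriv_cutoff_props hθ' hκ₁c hκ₁T
  have hκT₁ : tsupport (deriv (deriv θ)) ⊆ Iio T₁ := tsupport_deriv_subset.trans (tsupport_deriv_subset.trans hθT)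
  have hu : LocallyIntegrableOn (uncurry u) (Iio 0 ×ˢ (univ : Set (EuclideanSpace ℝ (Fin 3)))) volume := by
    simpa only [coe_slab] using hdist.1
  -- (i) incompressibility, time-tested with `θ''`
  have hdiv : ∀ g : EuclideanSpace ℝ (Fin 3) → ℝ, IsTestFunctionOn (⊤ : Opens (EuclideanSpace ℝ (Fin 3))) g →
      ∫ z : ℝ × EuclideanSpace ℝ (Fin 3), deriv (deriv θ) z.1 * ⟪u z.1 z.2, gradient g z.2⟫ = 0 := by
    intro g hg
    have hg' : IsTestFunctionOn (⟨univ, isOpen_univ⟩ : Opens (EuclideanSpace ℝ (Fin 3))) g :=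
      ⟨hg.contDiff, hg.hasCompactSupport, fun _ _ => trivial⟩
    have hΘ : IsSpaceTimeTestOn (slab (EuclideanSpace ℝ (Fin 3)) (Iio 0) isOpen_Iio) (fun t x => deriv (deriv θ) t • g x) :=
      isSpaceTimeTestOn_prod_smul isOpen_Iio isOpen_univ hθ'' hκc hκT hg'
    have H := hdist.2.2.2.1 _ hΘ
    have hgd : Differentiable ℝ g := hg.contDiff.differentiable (by simp)
    have hpt : ∀ z : ℝ × EuclideanSpace ℝ (Fin 3),
        ⟪u z.1 z.2, gradient (fun x => deriv (deriv θ) z.1 • g x) z.2⟫ = deriv (deriv θ) z.1 * ⟪u z.1 z.2, gradient g z.2⟫ := by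
      intro z
      have e : (fun x => deriv (deriv θ) z.1 • g x) = fun x => deriv (deriv θ) z.1 * g x := rfl
      rw [e, ClockRigidity.gradient_const_mul' (hgd z.2), real_inner_smul_right]
    have hvan : ∀ z : ℝ × EuclideanSpace ℝ (Fin 3), z ∉ Iio (0 : ℝ) ×ˢ (univ : Set (EuclideanSpace ℝ (Fin 3))) →
        deriv (deriv θ) z.1 * ⟪u z.1 z.2, gradient g z.2⟫ = 0 := by
      intro z hz
      have ht : (0 : ℝ) ≤ z.1 := by
        by_contra h
        exact hz ⟨not_le.1 h, mem_univ _⟩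
      rw [AntiMember.deriv_eq_zero_of_tsupport_subset_Iio hκ₁T ht, zero_mul]
    have H' : ∫ z in Iio (0 : ℝ) ×ˢ (univ : Set (EuclideanSpace ℝ (Fin 3))),
        deriv (deriv θ) z.1 * ⟪u z.1 z.2, gradient g z.2⟫ = 0 := by
      refine Eq.trans ?_ H
      rw [coe_slab]
      exact setIntegral_congr_fun (measurableSet_Iio.prod MeasurableSet.univ) (fun z _ => (hpt z).symm)
    rwa [setIntegral_eq_integral_of_forall_compl_eq_zero hvan] at H'
  -- (ii) weak curl-freeness of the time-tested field, from the frozen advection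
  have hcurl : ∀ g : EuclideanSpace ℝ (Fin 3) → ℝ, IsTestFunctionOn (⊤ : Opens (EuclideanSpace ℝ (Fin 3))) g →
      ∀ a c : EuclideanSpace ℝ (Fin 3),
        ∫ z : ℝ × EuclideanSpace ℝ (Fin 3), deriv (deriv θ) z.1 * ⟪u z.1 z.2, fderiv ℝ g z.2 a • c - fderiv ℝ g z.2 c • a⟫ = 0 := by
    intro g hg a c'
    exact integral_deriv2_mul_inner_divFree_eq_zero hT₁ hdist hθ hθc hθT (isTestFunctionOn_curlPair hg a c')
      (isDivFree_curlPair_of_contDiff (hg.contDiff.of_le (by norm_cast)) a c') (hfrozen θ hθ hθc hθT g hg a c')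
  -- (iii) growth from the `A`-gauge
  obtain ⟨M, hM⟩ := hκ.bounded_above_of_compact_support hκc
  obtain ⟨a₀, ha₀⟩ := hκc.isCompact.bddBelow
  set a : ℝ := min (a₀ - 1) (T₁ - 1) with hadef
  have hab : a < T₁ := lt_of_le_of_lt (min_le_right _ _) (by linarith)
  have hκS : ∀ t ∉ Ioo a T₁, deriv (deriv θ) t = 0 := by
    intro t ht
    by_contra hne
    have hts : t ∈ tsupport (deriv (deriv θ)) := subset_tsupport _ hne
    exact ht ⟨lt_of_le_of_lt (min_le_left _ _) (by linarith [ha₀ hts]), hκT₁ hts⟩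
  have hum : AEStronglyMeasurable (uncurry u) (volume.restrict (Iio (0 : ℝ) ×ˢ (univ : Set (EuclideanSpace ℝ (Fin 3))))) :=
    hu.aestronglyMeasurable
  set r₀ : ℝ := |a| + 1 with hr₀def
  have hgrowth : ∀ r : ℝ, r₀ < r → 0 < r →
      ∫⁻ x in ball (0 : EuclideanSpace ℝ (Fin 3)) r, ‖∫ t, deriv (deriv θ) t • u t x‖ₑ ^ 2 ≤
        ENNReal.ofReal (M ^ 2 * (T₁ - a) * ((T₁ - a) * c) * r ^ (1 - 2 * ρ)) := by
    intro r hr hr0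
    have hr1 : 1 < r := by
      have : (0 : ℝ) ≤ |a| := abs_nonneg a
      linarith
    have hra : -(r ^ 2) < a := by
      have h1 : |a| < r := by linarith [abs_nonneg a]
      have h2 : r < r ^ 2 := by nlinarith
      have h3 : -|a| ≤ a := neg_abs_le a
      linarith
    have hB : ∀ t ∈ Ioo a T₁, ∫⁻ x in ball (0 : EuclideanSpace ℝ (Fin 3)) r, ‖u t x‖ₑ ^ 2 ≤
        ENNReal.ofReal ((c : ℝ) * r ^ (1 - 2 * ρ)) := fun t ht =>
      Backward.lintegral_ball_le_of_gaugeA hr0 (hA r hr0) ⟨by linarith [ht.1], lt_of_lt_of_le ht.2 hT₁⟩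
    have h1 := AntiMember.lintegral_ball_timeTested_le hum hT₁ hκS hM hB
    refine h1.trans (le_of_eq ?_)
    have hM0 : 0 ≤ M := (norm_nonneg _).trans (hM 0)
    have hTa : 0 ≤ T₁ - a := by linarith
    rw [← ENNReal.ofReal_mul (sq_nonneg M), ← ENNReal.ofReal_mul hTa, ← ENNReal.ofReal_mul (mul_nonneg (sq_nonneg M) hTa)]
    congr 1
    ring
  have hm : 1 - 2 * ρ < 3 := by linarith
  have hw0 := AntiMember.timeTested_ae_eq_zero hu hκ hκc hκT hdiv hcurl hm hgrowth
  rw [← AntiMember.integral_inner_timeTested hu hκ hκc hκT hΦ hΦc]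
  have : (fun x => ⟪(∫ t, deriv (deriv θ) t • u t x), Φ x⟫) =ᵐ[volume] fun _ => (0 : ℝ) := by
    filter_upwards [hw0] with x hx
    rw [hx]; simp
  rw [integral_congr_ae this, integral_zero]

end FrozenLamb

/-! ## 3. Member kill and binder language -/

/-- **NO FROZEN LAMB TERM IN THE FAR PAST** (member level, every `ρ > 0`, no regularity beyond the class, no ansatz).  Crux hypotheses verbatim, `T₁ ≤ 0`,
and the velocity-tested advection steady in `𝒟'((−∞,T₁))` on curl pairs: `∫∫ θ'(t) ⟪u, Dη[u]⟫ = 0` for all `θ ∈ C_c^∞((−∞,T₁))` and all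
`η = (∂ₐg)b − (∂_b g)a`, `g ∈ C_c^∞(ℝ³)`.  Then `u = 0` a.e. on the slab (`∂ₜ²u = 0` in `𝒟'` by `FrozenLamb.integral_deriv2_mul_inner_eq_zero`, then
`Loc.ae_eq_zero_of_distributionallyAffinePast`). [folklore; MajdaBertozziCUP2002 §2.4] -/
theorem Loc.ae_eq_zero_of_frozenLambCurlPast {ρ : ℝ} (hρ : 0 < ρ)
    {u : ℝ → EuclideanSpace ℝ (Fin 3) → EuclideanSpace ℝ (Fin 3)} {p : ℝ → EuclideanSpace ℝ (Fin 3) → ℝ}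
    {H : ℝ → EuclideanSpace ℝ (Fin 3) → EuclideanSpace ℝ (Fin 3) →L[ℝ] EuclideanSpace ℝ (Fin 3)} {c : ℝ≥0}
    (hsw : IsSuitableWeakSolutionOn (slab (EuclideanSpace ℝ (Fin 3)) (Iio 0) isOpen_Iio) 0 0 u p)
    (hH : HasWeakSpatialGradientOn (slab (EuclideanSpace ℝ (Fin 3)) (Iio 0) isOpen_Iio) u H)
    (hc : ∀ a : ℝ, 0 < a → ENNReal.ofReal (a ^ (2 * ρ)) * cknA a (0 : ℝ × EuclideanSpace ℝ (Fin 3)) u +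
        ENNReal.ofReal (a ^ ρ) * cknE a (0 : ℝ × EuclideanSpace ℝ (Fin 3)) H +
        ENNReal.ofReal (a ^ (2 * ρ)) * cknD a (0 : ℝ × EuclideanSpace ℝ (Fin 3)) p ≤ (c : ℝ≥0∞))
    {T₁ : ℝ} (hT₁ : T₁ ≤ 0)
    (hfrozen : ∀ θ : ℝ → ℝ, ContDiff ℝ ∞ θ → HasCompactSupport θ → tsupport θ ⊆ Iio T₁ →
      ∀ g : EuclideanSpace ℝ (Fin 3) → ℝ, IsTestFunctionOn (⊤ : Opens (EuclideanSpace ℝ (Fin 3))) g → ∀ a b : EuclideanSpace ℝ (Fin 3),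
        ∫ z : ℝ × EuclideanSpace ℝ (Fin 3), deriv θ z.1 *
          ⟪u z.1 z.2, fderiv ℝ (fun x => fderiv ℝ g x a • b - fderiv ℝ g x b • a) z.2 (u z.1 z.2)⟫ = 0) :
    uncurry u =ᵐ[volume.restrict (Iio (0 : ℝ) ×ˢ (univ : Set (EuclideanSpace ℝ (Fin 3))))] 0 := by
  have hA : ∀ a : ℝ, 0 < a → ENNReal.ofReal (a ^ (2 * ρ)) *
      cknA a (0 : ℝ × EuclideanSpace ℝ (Fin 3)) u ≤ (c : ℝ≥0∞) :=
    fun a ha => le_trans (le_trans le_self_add le_self_add) (hc a ha)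
  exact Loc.ae_eq_zero_of_distributionallyAffinePast hρ hsw hH hc hT₁ fun θ hθ hθc hθT Φ hΦ hΦc =>
    FrozenLamb.integral_deriv2_mul_inner_eq_zero (by linarith) hsw hA hT₁ hfrozen hθ hθc hθT hΦ hΦc

/-- **NO FROZEN ADVECTION IN THE FAR PAST** — the same with the hypothesis on ALL divergence-free vector test fields `η`: `∫∫ θ'(t) ⟪u, Dη[u]⟫ = 0` for
all `θ ∈ C_c^∞((−∞,T₁))` ⇒ `u = 0` a.e. [folklore] -/
theorem Loc.ae_eq_zero_of_frozenAdvectionPast {ρ : ℝ} (hρ : 0 < ρ)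
    {u : ℝ → EuclideanSpace ℝ (Fin 3) → EuclideanSpace ℝ (Fin 3)} {p : ℝ → EuclideanSpace ℝ (Fin 3) → ℝ}
    {H : ℝ → EuclideanSpace ℝ (Fin 3) → EuclideanSpace ℝ (Fin 3) →L[ℝ] EuclideanSpace ℝ (Fin 3)} {c : ℝ≥0}
    (hsw : IsSuitableWeakSolutionOn (slab (EuclideanSpace ℝ (Fin 3)) (Iio 0) isOpen_Iio) 0 0 u p)
    (hH : HasWeakSpatialGradientOn (slab (EuclideanSpace ℝ (Fin 3)) (Iio 0) isOpen_Iio) u H)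
    (hc : ∀ a : ℝ, 0 < a → ENNReal.ofReal (a ^ (2 * ρ)) * cknA a (0 : ℝ × EuclideanSpace ℝ (Fin 3)) u +
        ENNReal.ofReal (a ^ ρ) * cknE a (0 : ℝ × EuclideanSpace ℝ (Fin 3)) H +
        ENNReal.ofReal (a ^ (2 * ρ)) * cknD a (0 : ℝ × EuclideanSpace ℝ (Fin 3)) p ≤ (c : ℝ≥0∞))
    {T₁ : ℝ} (hT₁ : T₁ ≤ 0)
    (hfrozen : ∀ θ : ℝ → ℝ, ContDiff ℝ ∞ θ → HasCompactSupport θ → tsupport θ ⊆ Iio T₁ →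
      ∀ η : EuclideanSpace ℝ (Fin 3) → EuclideanSpace ℝ (Fin 3), IsTestFunctionOn (⊤ : Opens (EuclideanSpace ℝ (Fin 3))) η →
        (∀ x, VectorCalculus.divergence η x = 0) →
          ∫ z : ℝ × EuclideanSpace ℝ (Fin 3), deriv θ z.1 * ⟪u z.1 z.2, fderiv ℝ η z.2 (u z.1 z.2)⟫ = 0) :
    uncurry u =ᵐ[volume.restrict (Iio (0 : ℝ) ×ˢ (univ : Set (EuclideanSpace ℝ (Fin 3))))] 0 :=
  Loc.ae_eq_zero_of_frozenLambCurlPast hρ hsw hH hc hT₁ fun θ hθ hθc hθT g hg a b =>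
    hfrozen θ hθ hθc hθT _ (isTestFunctionOn_curlPair hg a b) (isDivFree_curlPair_of_contDiff (hg.contDiff.of_le (by norm_cast)) a b)

/-- **Binder language: NO MEMBER HAS A FROZEN LAMB TERM IN ITS FAR PAST** (every `ρ > 0`, no regularity beyond the class, no ansatz): a class member
whose velocity-tested advection `η ↦ ∫ (u ⊗ u)(t) : ∇η` on divergence-free test fields — equivalently the Leray projection `P(ω × u)` of its
Lamb vector — is steady in `𝒟'((−∞,T₁))`, some `T₁ ≤ 0`, is trivial.  A closed sub-stratum of `stub_nonSelfSimilarRest` containing the steady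
(`…_of_aePastSteady`, `…_of_distributionallySteadyPast`), Beltrami (`…_of_weakLambCurlFreePast`, `…_of_aeBeltramiPast`, `…_of_aeLambGradientPast`)
and affine-in-time (`…_of_aeAffineTimePast`, `…_of_distributionallyAffinePast`) strata. [folklore] -/
theorem Birth.nonSelfSimilar_of_frozenAdvectionPast :
    ∀ ρ : ℝ, 0 < ρ →
      ∀ (u : ℝ → EuclideanSpace ℝ (Fin 3) → EuclideanSpace ℝ (Fin 3)) (p : ℝ → EuclideanSpace ℝ (Fin 3) → ℝ)
        (H : ℝ → EuclideanSpace ℝ (Fin 3) → EuclideanSpace ℝ (Fin 3) →L[ℝ] EuclideanSpace ℝ (Fin 3)) (c : ℝ≥0),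
        Birth.InClass ρ u p H c →
          (∃ T₁ : ℝ, T₁ ≤ 0 ∧ ∀ θ : ℝ → ℝ, ContDiff ℝ ∞ θ → HasCompactSupport θ → tsupport θ ⊆ Iio T₁ →
              ∀ η : EuclideanSpace ℝ (Fin 3) → EuclideanSpace ℝ (Fin 3), IsTestFunctionOn (⊤ : Opens (EuclideanSpace ℝ (Fin 3))) η →
                (∀ x, VectorCalculus.divergence η x = 0) →
                  ∫ z : ℝ × EuclideanSpace ℝ (Fin 3), deriv θ z.1 * ⟪u z.1 z.2, fderiv ℝ η z.2 (u z.1 z.2)⟫ = 0) →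
          uncurry u =ᵐ[volume.restrict (Iio (0 : ℝ) ×ˢ (univ : Set (EuclideanSpace ℝ (Fin 3))))] 0 := by
  intro ρ hρ u p H c hcl h
  obtain ⟨T₁, hT₁, hfrozen⟩ := h
  exact Loc.ae_eq_zero_of_frozenAdvectionPast hρ hcl.1 hcl.2.1 hcl.2.2 hT₁ hfrozen

/-- **Binder language, curl-pair form**: velocity-tested advection steady in `𝒟'((−∞,T₁))` on all curl pairs `η = (∂ₐg)b − (∂_b g)a` ⇒ trivial.
[folklore] -/
theorem Birth.nonSelfSimilar_of_frozenLambCurlPast :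
    ∀ ρ : ℝ, 0 < ρ →
      ∀ (u : ℝ → EuclideanSpace ℝ (Fin 3) → EuclideanSpace ℝ (Fin 3)) (p : ℝ → EuclideanSpace ℝ (Fin 3) → ℝ)
        (H : ℝ → EuclideanSpace ℝ (Fin 3) → EuclideanSpace ℝ (Fin 3) →L[ℝ] EuclideanSpace ℝ (Fin 3)) (c : ℝ≥0),
        Birth.InClass ρ u p H c →
          (∃ T₁ : ℝ, T₁ ≤ 0 ∧ ∀ θ : ℝ → ℝ, ContDiff ℝ ∞ θ → HasCompactSupport θ → tsupport θ ⊆ Iio T₁ →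
              ∀ g : EuclideanSpace ℝ (Fin 3) → ℝ, IsTestFunctionOn (⊤ : Opens (EuclideanSpace ℝ (Fin 3))) g →
                ∀ a b : EuclideanSpace ℝ (Fin 3),
                  ∫ z : ℝ × EuclideanSpace ℝ (Fin 3), deriv θ z.1 *
                    ⟪u z.1 z.2, fderiv ℝ (fun x => fderiv ℝ g x a • b - fderiv ℝ g x b • a) z.2 (u z.1 z.2)⟫ = 0) →
          uncurry u =ᵐ[volume.restrict (Iio (0 : ℝ) ×ˢ (univ : Set (EuclideanSpace ℝ (Fin 3))))] 0 := by
  intro ρ hρ u p H c hcl h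
  obtain ⟨T₁, hT₁, hfrozen⟩ := h
  exact Loc.ae_eq_zero_of_frozenLambCurlPast hρ hcl.1 hcl.2.1 hcl.2.2 hT₁ hfrozen

end Summit.NavierStokesRegularity.NavierStokesRegularity.Theorems.PowerGaugeEulerLiouville

end
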